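import Summits.ResolutionOfSingularities.ResolutionOfSingularities.Theorems.EquisingularLiftEquisingularLiftNatNDSingularGradient
import Summits.ResolutionOfSingularities.ResolutionOfSingularities.Theorems.EquisingularLiftEquisingularLiftNatNDLocalNDSquarefree
import Summits.ResolutionOfSingularities.ResolutionOfSingularities.Theorems.EquisingularLiftEquisingularLiftNatNDProjFrame
import Summits.ResolutionOfSingularities.ResolutionOfSingularities.Theorems.EquisingularLiftEquisingularLiftNatRegularCase
import Literature.AlgebraicGeometry.Motives.ProjectiveSpaceFieldPoints
import Literature.AlgebraicGeometry.Resolution.PrimeDivisorIdeals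
import Mathlib.Algebra.Squarefree.Basic
import Mathlib.RingTheory.Nilpotent.Lemmas
import HarnessLib

/-!
# [OURS · L1 W4.5(b) · EL♮(3)] DEAL «ND-K5», brick (B4γ) `ND.ndInv_init` BY NAME — the local ND frame at every non-regular point
# (`…NatNDInvInit`; WIDTH TABLE D1 row nose-w1; desk succession ruling 2026-08-28T14:56:41Z «ownership of (B4γ) passes to nose-w1»)

Cell `res-hironaka`, crux EL♮(3) `EquisingularLiftNatThree` (stmt-ResolutionOfSingularities-20148), chain W4.5b, line `sections`.
res-L1-w45b-nose-w1 g0 (owner of (B4γ)), on res-type-027 g19's sub-brick map `L/res-type-027/g19/B4g-FEASIBILITY.md` 1f63f2055c4d1e10 with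
res-type-027 g19/g20 as second hand ((γ3a) p643089, (γ3b) p643663, (γ4) p645036).  OURS; NOT a statement of any manuscript; nothing of
[Hironaka2017] is asserted; AI-written kernel work, weaker than expert review.  Def-free, `sorry`-free, standard axioms; one file-local
instance attribute `MvPolynomial.gradedAlgebra` (needed to SPEAK of `x.asHomogeneousIdeal` for points of `ℙⁿ_k = Proj k[x₀..xₙ]`; identical
to `…NatNDProjChart` / `Literature/…/ProjectiveSpaceCells`).  `--kind proof --supports stmt-ResolutionOfSingularities-20148 --as helper`.

THE BRICK.  `ND.ndInv_init` = SPEC `Cruxes/EquisingularLiftNatThree/NewtonNondegenerateRungK5.lean` (v12 99465c56d0b22ab5) §13.10 l.212 signature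
VERBATIM (binders `_hp`, `_hloc` unused — the prime `p`, `CharP` and the «ideal locally principal» hypothesis are not needed): under
`IsoHypNDWon k n H ι` and finiteness of the non-regular locus, `∃ m, ND.NDInv n k m ℙⁿ_k (𝟙 _) (range ι)`.  It is consumed by name in the
spec's (B4) `hres_toricRounds` (`obtain ⟨m, hm⟩ := ndInv_init n p hp k H ι hι hH hloc hfin hND`), i.e. by lead-2's closing file
`…NatNDRungClosure` for the registered stub `stub_elnat_three_isolated_newtonNondegenerate`.

ASSEMBLY (§3 `exists_isNDFrameAt_of_isoHypNDWon`, then `ndInv_init`): `ℙⁿ_k` regular (tree `isRegular_projectiveSpace`) · the `S`-block =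
(γ2) `exists_finset_nonregular_range` (p642906) · at `x ∈ S`: `n ≥ 2` (tree `isRegular_of_isClosedImmersion_projectiveSpace_of_le_one`),
homogeneous coordinates with the zero-locus dictionary (§2, over (γ3a) `exists_chartι_apply_eq` / `mem_asHomogeneousIdeal_chartι_iff`),
`F(a) = 0`, `∇F(a) = 0` by (γ6) `eval_pderiv_eq_zero_of_not_isRegularLocalRing` (p645163), `IsoHypNDWon` ⇒ chart `i`, `θ`,
`g = localEquation F a i θ ∈ LocalNDWon`; rescale `aᵢ = 1` and re-chart (§2 `exists_chartι_eq_of_coords`); chart ring map `χ` (γ3b)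
`exists_chartRingHom` (p643663); frame (γ4) `exists_frame_localEquation` (p645036) with `g(w) = χ f`; `(𝓘_{range ι})_x = (χ f)` by (γ6)
`stalkIdeal_vanishingIdeal_closure_range_eq_span` since `χ f` is squarefree in the factorial `𝒪_{ℙⁿ,x}` — §1 descent
`squarefree_algebraMap_of_forall_not_sq_dvd` + (γ5) `sq_dvd_false_of_localND` (p644264).

References (mathematics): A. G. Kouchnirenko, Invent. Math. 32 (1976) §1; H. Matsumura, *Commutative Ring Theory* (1986) Thms. 14.2/14.3,
20.3 [Matsumura1987]; R. Hartshorne, *Algebraic Geometry* (1977) II Prop. 2.5, II Ex. 3.2.6 [Hartshorne1977].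
-/

set_option linter.dupNamespace false

noncomputable section

open CategoryTheory AlgebraicGeometry TopologicalSpace IsLocalRing MvPolynomial
open AlgebraicGeometry.Scheme.IdealSheafData
open Literature.AlgebraicGeometry.Resolution
open Literature.AlgebraicGeometry.Motives

namespace Summit.ResolutionOfSingularities.ResolutionOfSingularities.Cruxes.EquisingularLiftNat.Sections.ND

open Summit.ResolutionOfSingularities.ResolutionOfSingularities.Cruxes.EquisingularLiftNat.Sections

attribute [local instance] MvPolynomial.gradedAlgebra

/-! ## §1 Descent of square factors from a localisation at a rational point -/

/-- **No square factor through `b` downstairs ⇒ squarefree in the localisation at `b`**: if a non-zero polynomial `f` is divisible by no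
`P²` with `P(b) = 0`, then its image in a localisation `S` of `k[t]` at the point `b` is squarefree (a non-unit square factor upstairs
descends to `r² ∣ f·m` with `r(b) = 0`, `m(b) ≠ 0`, and a prime factor of `r` through `b` squares into `f`). [folklore] -/
theorem squarefree_algebraMap_of_forall_not_sq_dvd {k : Type} [Field k] {n : ℕ} {S : Type*} [CommRing S]
    [Algebra (MvPolynomial (Fin n) k) S] (Q : Ideal (MvPolynomial (Fin n) k)) [Q.IsPrime] [IsLocalization.AtPrime S Q]
    (b : Fin n → k) (hQ : ∀ p, p ∈ Q ↔ MvPolynomial.eval b p = 0) {f : MvPolynomial (Fin n) k} (hf : f ≠ 0)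
    (hsq : ∀ P : MvPolynomial (Fin n) k, MvPolynomial.eval b P = 0 → ¬ (P * P ∣ f)) :
    Squarefree (algebraMap (MvPolynomial (Fin n) k) S f) := by
  classical
  intro p hp
  by_contra hpu
  -- write `p = r / s`
  obtain ⟨⟨r, s⟩, hrs⟩ := IsLocalization.surj Q.primeCompl p
  simp only at hrs
  have hrQ : r ∈ Q := by
    by_contra hr
    have hu : IsUnit (algebraMap (MvPolynomial (Fin n) k) S r) :=
      (IsLocalization.AtPrime.isUnit_to_map_iff S Q r).mpr hr
    rw [← hrs] at hu
    exact hpu (isUnit_of_mul_isUnit_left hu)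
  -- `p² ∣ f` upstairs descends to `r² ∣ f · m` downstairs with `m ∉ Q`
  obtain ⟨c, hc⟩ := hp
  obtain ⟨⟨r', s'⟩, hrs'⟩ := IsLocalization.surj Q.primeCompl c
  simp only at hrs'
  have heq : algebraMap (MvPolynomial (Fin n) k) S (f * ((s : MvPolynomial (Fin n) k) * s * s')) =
      algebraMap (MvPolynomial (Fin n) k) S (r * r * r') := by
    rw [map_mul, map_mul, map_mul, map_mul, map_mul, hc, ← hrs, ← hrs']
    ring
  obtain ⟨⟨u, hu⟩, hu'⟩ := (IsLocalization.eq_iff_exists Q.primeCompl S).mp heq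
  simp only at hu'
  set m : MvPolynomial (Fin n) k := u * ((s : MvPolynomial (Fin n) k) * s * s') with hm
  have hmQ : m ∉ Q := by
    have hs := s.2; have hs' := s'.2
    rw [hm]
    intro h
    rcases (Ideal.IsPrime.mem_or_mem ‹Q.IsPrime› h) with h1 | h1
    · exact hu h1
    rcases (Ideal.IsPrime.mem_or_mem ‹Q.IsPrime› h1) with h2 | h2
    · rcases (Ideal.IsPrime.mem_or_mem ‹Q.IsPrime› h2) with h3 | h3
      · exact hs h3
      · exact hs h3
    · exact hs' h2
  have hdvd : r * r ∣ f * m := ⟨u * r', by rw [hm]; linear_combination hu'⟩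
  have hm0 : m ≠ 0 := fun h => hmQ (h ▸ Q.zero_mem)
  have hr0 : r ≠ 0 := by
    rintro rfl
    rw [zero_mul, zero_dvd_iff, mul_eq_zero] at hdvd
    rcases hdvd with h | h
    · exact hf h
    · exact hm0 h
  -- a prime factor `P` of `r` lying in `Q`
  have hprod : (UniqueFactorizationMonoid.factors r).prod ∈ Q := by
    obtain ⟨v, hv⟩ := UniqueFactorizationMonoid.factors_prod hr0
    rw [← hv] at hrQ
    exact (Ideal.IsPrime.mem_or_mem ‹Q.IsPrime› hrQ).resolve_right fun h =>
      Ideal.IsPrime.ne_top ‹Q.IsPrime› (Ideal.eq_top_of_isUnit_mem _ h v.isUnit)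
  obtain ⟨P, hPf, hPQ⟩ := (Ideal.IsPrime.multiset_prod_mem_iff_exists_mem ‹Q.IsPrime› _).mp hprod
  have hPprime : Prime P := UniqueFactorizationMonoid.prime_of_factor P hPf
  have hPr : P ∣ r := UniqueFactorizationMonoid.dvd_of_mem_factors hPf
  have hPm : ¬ P ∣ m := fun ⟨t, ht⟩ => hmQ (ht ▸ Ideal.mul_mem_right t Q hPQ)
  -- `P² ∣ f`
  have hP2 : P * P ∣ f * m := (mul_dvd_mul hPr hPr).trans hdvd
  have hPf1 : P ∣ f := ((hPprime.dvd_or_dvd (dvd_trans (dvd_mul_right P P) hP2)).resolve_right hPm)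
  obtain ⟨f₁, rfl⟩ := hPf1
  have hPf2 : P ∣ f₁ := by
    rw [mul_assoc] at hP2
    have := (mul_dvd_mul_iff_left hPprime.ne_zero).mp hP2
    exact (hPprime.dvd_or_dvd this).resolve_right hPm
  exact hsq P ((hQ P).mp hPQ) (mul_dvd_mul_left P hPf2)

/-! ## §2 Points of `ℙⁿ_k`: homogeneous coordinates and re-charting -/

/-- A non-zero homogeneous polynomial lying in a (relevant, proper) homogeneous prime has positive degree. [folklore] -/
theorem pos_of_isHomogeneous_of_mem {k : Type} [Field k] {n d : ℕ} {F : MvPolynomial (Fin (n + 1)) k}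
    (hF : F.IsHomogeneous d) (hF0 : F ≠ 0) {I : Ideal (MvPolynomial (Fin (n + 1)) k)} (hI : I ≠ ⊤) (hmem : F ∈ I) : 0 < d := by
  by_contra hd
  have hd0 : d = 0 := by omega
  subst hd0
  have hdeg : F.totalDegree = 0 := le_antisymm hF.totalDegree_le (Nat.zero_le _)
  have hC : F = C (coeff 0 F) := totalDegree_eq_zero_iff_eq_C.mp hdeg
  have hc0 : coeff 0 F ≠ 0 := fun h => hF0 (by rw [hC, h, C_0])
  have hunit : IsUnit F := by rw [hC]; exact (IsUnit.mk0 _ hc0).map C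
  exact hI (Ideal.eq_top_of_isUnit_mem I hmem hunit)

/-- **Homogeneous coordinates of a closed point of `ℙⁿ_k`** (`k` algebraically closed), with the zero-locus dictionary: a vector `a`
with `aᵢ = 1` for some `i` such that a homogeneous `G` of positive degree lies in `𝔭_x` iff `G(a) = 0` (the point lies in a standard chart at
a rational point — tree `exists_chartι_apply_eq` — and `G ∈ 𝔭_{chartι y} ↔ G(xᵢ:=1) ∈ 𝔭_y`, `mem_asHomogeneousIdeal_chartι_iff`).
[cite: Hartshorne1977, II Prop. 2.5] -/
theorem exists_coords_of_isClosed {k : Type} [Field k] [IsAlgClosed k] {n : ℕ}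
    (x : Proj (MvPolynomial.homogeneousSubmodule (Fin (n + 1)) k)) (hx : IsClosed ({x} : Set (Proj (MvPolynomial.homogeneousSubmodule (Fin (n + 1)) k)))) :
    ∃ (a : Fin (n + 1) → k) (i : Fin (n + 1)), a i = 1 ∧ ∀ (m : ℕ), 0 < m → ∀ (G : MvPolynomial (Fin (n + 1)) k),
      G ∈ MvPolynomial.homogeneousSubmodule (Fin (n + 1)) k m →
      (G ∈ (x : ProjectiveSpectrum (MvPolynomial.homogeneousSubmodule (Fin (n + 1)) k)).asHomogeneousIdeal ↔ MvPolynomial.eval a G = 0) := by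
  obtain ⟨i, b, y₀, hy₀, rfl⟩ := exists_chartι_apply_eq k n x hx
  have hai : Fin.insertNth (α := fun _ => k) i 1 b i = 1 := by simp
  refine ⟨Fin.insertNth i 1 b, i, hai, fun m hm G hG => ?_⟩
  rw [mem_asHomogeneousIdeal_chartι_iff k n i hm hG y₀, hy₀, MvPolynomial.mem_vanishingIdeal_singleton_iff,
    ← ProjectiveSpace.eval_dehomogenize i (Fin.insertNth (α := fun _ => k) i 1 b) hai G]
  have hb : (fun j => Fin.insertNth (α := fun _ => k) i 1 b (i.succAbove j)) = b := by
    funext j; simp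
  rw [hb]
  rfl

/-- The zero-locus dictionary is invariant under rescaling the coordinates by a unit. [folklore] -/
theorem coords_dictionary_smul {k : Type} [Field k] {n : ℕ}
    {x : Proj (MvPolynomial.homogeneousSubmodule (Fin (n + 1)) k)} {a : Fin (n + 1) → k}
    (hD : ∀ (m : ℕ), 0 < m → ∀ (G : MvPolynomial (Fin (n + 1)) k), G ∈ MvPolynomial.homogeneousSubmodule (Fin (n + 1)) k m →
      (G ∈ (x : ProjectiveSpectrum (MvPolynomial.homogeneousSubmodule (Fin (n + 1)) k)).asHomogeneousIdeal ↔ MvPolynomial.eval a G = 0))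
    {c : k} (hc : c ≠ 0) :
    ∀ (m : ℕ), 0 < m → ∀ (G : MvPolynomial (Fin (n + 1)) k), G ∈ MvPolynomial.homogeneousSubmodule (Fin (n + 1)) k m →
      (G ∈ (x : ProjectiveSpectrum (MvPolynomial.homogeneousSubmodule (Fin (n + 1)) k)).asHomogeneousIdeal ↔
        MvPolynomial.eval (c • a) G = 0) := by
  intro m hm G hG
  rw [hD m hm G hG]
  have h : MvPolynomial.eval (c • a) G = c ^ m * MvPolynomial.eval a G :=
    ProjectiveSpace.isHomogeneous_aeval_const_mul ((MvPolynomial.mem_homogeneousSubmodule m G).mp hG) c a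
  rw [h, mul_eq_zero, or_iff_right (pow_ne_zero m hc)]

/-- **Re-charting at a chosen index**: if `aᵢ = 1` for homogeneous coordinates `a` of `x` (zero-locus dictionary), then `x = chartι i y₀`
for the point `y₀` of the `i`-th chart whose prime is the ideal of the rational point `(a_{i.succAbove j})ⱼ` (membership of a polynomial
`p` is read on a homogenisation `G` of `p`, tree `exists_isHomogeneous_dehomogenize_eq`). [cite: Hartshorne1977, II Prop. 2.5] -/
theorem exists_chartι_eq_of_coords {k : Type} [Field k] {n : ℕ}
    (x : Proj (MvPolynomial.homogeneousSubmodule (Fin (n + 1)) k)) (a : Fin (n + 1) → k) (i : Fin (n + 1)) (ha : a i = 1)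
    (hD : ∀ (m : ℕ), 0 < m → ∀ (G : MvPolynomial (Fin (n + 1)) k), G ∈ MvPolynomial.homogeneousSubmodule (Fin (n + 1)) k m →
      (G ∈ (x : ProjectiveSpectrum (MvPolynomial.homogeneousSubmodule (Fin (n + 1)) k)).asHomogeneousIdeal ↔ MvPolynomial.eval a G = 0)) :
    ∃ y₀ : Spec (CommRingCat.of (MvPolynomial (Fin n) k)), ProjectiveSpaceCells.chartι k n i y₀ = x ∧
      ∀ p, p ∈ y₀.asIdeal ↔ MvPolynomial.eval (fun j => a (i.succAbove j)) p = 0 := by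
  -- `x` lies in the `i`-th chart
  have hxi : x ∈ Set.range (ProjectiveSpaceCells.chartι k n i).base := by
    rw [ProjectiveSpaceCells.range_chartι]
    change x ∈ Proj.basicOpen (MvPolynomial.homogeneousSubmodule (Fin (n + 1)) k) (X i)
    rw [Proj.mem_basicOpen]
    intro hmem
    have := (hD 1 one_pos (X i) (ProjectiveSpace.X_mem i)).mp hmem
    rw [MvPolynomial.eval_X, ha] at this
    exact one_ne_zero this
  obtain ⟨y₀, rfl⟩ := hxi
  refine ⟨y₀, rfl, fun p => ?_⟩
  obtain ⟨G, hG, hGp⟩ := ProjectiveSpace.exists_isHomogeneous_dehomogenize_eq k i p (Nat.le_succ p.totalDegree)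
  rw [← hGp, ← mem_asHomogeneousIdeal_chartι_iff k n i (Nat.succ_pos _) ((MvPolynomial.mem_homogeneousSubmodule _ G).mpr hG) y₀,
    hD _ (Nat.succ_pos _) G ((MvPolynomial.mem_homogeneousSubmodule _ G).mpr hG),
    ProjectiveSpace.eval_dehomogenize i a ha G]

/-! ## §3 (γ7): THE LOCAL ND FRAME at a non-regular point, and `ndInv_init` BY NAME -/

/-- **The local ND frame at a non-regular point** — the heart of (B4γ): for `ι : H ⟶ ℙⁿ_k` a closed immersion from an integral scheme
with `IsoHypNDWon k n H ι`, every NON-REGULAR point `x₀` of `H` with closed image `x` carries local ND frame data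
`ND.IsNDFrameAt n k (𝟙 ℙⁿ) (range ι) W x`.  Assembly of (γ2)–(γ6): `n ≥ 2` (tree `isRegular_of_isClosedImmersion_projectiveSpace_of_le_one`);
homogeneous coordinates `a` of `x` (§2); `F(a) = 0` from `V₊(F) = ι(H)`; `∇F(a) = 0` by (γ6); `IsoHypNDWon` then gives the chart `i`,
`θ` and `g = localEquation F a i θ ∈ LocalNDWon`; rescale `a` so that `aᵢ = 1`, re-chart at `i` (§2), take the chart ring map `χ` (γ3b) and the
frame (γ4) with `g(w) = χ f`; `(𝓘_{range ι})_x = (χ f)` because `χ f` is squarefree — no `P² ∣ f` through the point by (γ5), descended by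
§1 — in the factorial regular local ring `𝒪_{ℙⁿ,x}` (γ6's `stalkIdeal_vanishingIdeal_closure_range_eq_span`). [OURS · (B4γ) (γ7)] -/
theorem exists_isNDFrameAt_of_isoHypNDWon {k : Type} [Field k] [IsAlgClosed k] {n : ℕ} {H : Scheme.{0}}
    (ι : H ⟶ (projectiveSpace n k).left) [IsClosedImmersion ι] [IsIntegral H] (hND : IsoHypNDWon k n H ι)
    {x₀ : H} (hnreg : ¬ IsRegularLocalRing (H.presheaf.stalk x₀)) {x : (projectiveSpace n k).left} (hx₀ : ι x₀ = x)
    (hxcl : IsClosed ({x} : Set (projectiveSpace n k).left)) :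
    ∃ W : Fin n → (projectiveSpace n k).left.IdealSheafData, IsNDFrameAt n k (𝟙 (projectiveSpace n k).left) (Set.range ι) W x := by
  classical
  -- `n ≥ 2`
  have hn : 2 ≤ n := by
    by_contra hn
    exact hnreg (isRegular_of_isClosedImmersion_projectiveSpace_of_le_one ι (by omega) x₀)
  obtain ⟨d, F, hF, hF0, hZ, hpts⟩ := hND
  -- homogeneous coordinates of `x`
  obtain ⟨a₀, i₀, ha₀, hD₀⟩ := exists_coords_of_isClosed x hxcl
  -- `F ∈ 𝔭_x`, so `d > 0` and `F(a₀) = 0`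
  have hFx : F ∈ (x : ProjectiveSpectrum (MvPolynomial.homogeneousSubmodule (Fin (n + 1)) k)).asHomogeneousIdeal := by
    have hmem : x ∈ Set.range ι.base := ⟨x₀, hx₀⟩
    unfold IsZeroSetOf at hZ
    rw [hZ] at hmem
    exact hmem
  have hd : 0 < d := pos_of_isHomogeneous_of_mem hF hF0
    (I := (x : ProjectiveSpectrum (MvPolynomial.homogeneousSubmodule (Fin (n + 1)) k)).asHomogeneousIdeal.toIdeal)
    (x : ProjectiveSpectrum (MvPolynomial.homogeneousSubmodule (Fin (n + 1)) k)).isPrime.ne_top hFx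
  have hFmem : F ∈ MvPolynomial.homogeneousSubmodule (Fin (n + 1)) k d := (MvPolynomial.mem_homogeneousSubmodule d F).mpr hF
  have hFa₀ : MvPolynomial.eval a₀ F = 0 := (hD₀ d hd F hFmem).mp hFx
  have ha₀0 : a₀ ≠ 0 := fun h => by
    have := congrFun h i₀; rw [ha₀] at this; exact one_ne_zero this
  -- `∇F(a₀) = 0` by (γ6), in the chart `i₀`
  obtain ⟨y₀, hy₀x, hy₀⟩ := exists_chartι_eq_of_coords x a₀ i₀ ha₀ hD₀
  have hgrad : ∀ j, MvPolynomial.eval a₀ (pderiv j F) = 0 :=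
    eval_pderiv_eq_zero_of_not_isRegularLocalRing ι hnreg hd hF hZ i₀ ha₀ y₀ hy₀ (hy₀x.trans hx₀.symm)
  -- the ND data: a chart `i` with `a₀ i ≠ 0`, `θ`, `g ∈ LocalNDWon`
  obtain ⟨i, hai, θ, hθ, hLND⟩ := hpts a₀ ha₀0 hFa₀ hgrad
  -- rescale so that `a i = 1` and re-chart at `i`
  set a : Fin (n + 1) → k := (a₀ i)⁻¹ • a₀ with ha_def
  have ha : a i = 1 := by rw [ha_def, Pi.smul_apply, smul_eq_mul, inv_mul_cancel₀ hai]
  have hD : ∀ (m : ℕ), 0 < m → ∀ (G : MvPolynomial (Fin (n + 1)) k), G ∈ MvPolynomial.homogeneousSubmodule (Fin (n + 1)) k m →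
      (G ∈ (x : ProjectiveSpectrum (MvPolynomial.homogeneousSubmodule (Fin (n + 1)) k)).asHomogeneousIdeal ↔ MvPolynomial.eval a G = 0) :=
    coords_dictionary_smul hD₀ (inv_ne_zero hai)
  set b : Fin n → k := fun j => a (i.succAbove j) with hb_def
  have hb : b = fun j => a₀ (i.succAbove j) / a₀ i := by
    funext j; rw [hb_def, ha_def]; simp only [Pi.smul_apply, smul_eq_mul]; rw [div_eq_inv_mul]
  obtain ⟨y₁, hy₁x, hy₁⟩ := exists_chartι_eq_of_coords x a i ha hD
  have hy₁' : y₁.asIdeal = MvPolynomial.vanishingIdeal k {b} := by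
    ext p; rw [hy₁ p, MvPolynomial.mem_vanishingIdeal_singleton_iff]; exact Iff.rfl
  subst hy₁x
  -- the chart ring map and the frame
  obtain ⟨χ, hloc, hC, hχI, hχsupp⟩ := exists_chartRingHom k n i y₁
  set f : MvPolynomial (Fin n) k := ProjectiveSpace.dehomogenize k i F with hf_def
  obtain ⟨W, w, h1, h2, h3, h4⟩ := exists_frame_localEquation k n i b y₁ hy₁' χ hloc hC θ hθ f
  have hg : θ (translate b f) = localEquation F a₀ i θ := by
    rw [hb]; rfl
  refine ⟨W, w, θ (translate b f), h1, h2, h3, hg ▸ hLND, ?_⟩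
  rw [h4]
  -- `(𝓘_{range ι})_x = (χ f)`: `χ f` is squarefree in the factorial `𝒪_{ℙⁿ,x}`
  letI := χ.toAlgebra
  haveI : IsLocalization.AtPrime ((projectiveSpace n k).left.presheaf.stalk (ProjectiveSpaceCells.chartι k n i y₁)) y₁.asIdeal := hloc
  haveI : UniqueFactorizationMonoid ((projectiveSpace n k).left.presheaf.stalk (ProjectiveSpaceCells.chartι k n i y₁)) :=
    (isRegular_projectiveSpace n k).uniqueFactorizationMonoid_stalk _
  have hf0 : f ≠ 0 := by
    intro h
    apply hF0
    refine ProjectiveSpace.eq_of_dehomogenize_eq i hF (MvPolynomial.isHomogeneous_zero _ _ _) ?_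
    rw [← hf_def, h, map_zero]
  have hsq : Squarefree (χ f) :=
    squarefree_algebraMap_of_forall_not_sq_dvd y₁.asIdeal b hy₁ hf0 fun P hP hdvd =>
      sq_dvd_false_of_localND hn (hg ▸ hLND).1
        (show constantCoeff (θ (translate b P)) = 0 by
          rw [constantCoeff_apply_of_fixesOrigin θ hθ, constantCoeff_translate]; exact hP)
        (by
          have h1 : translate b P * translate b P ∣ translate b f := by
            unfold translate; rw [← map_mul]; exact map_dvd _ hdvd
          rw [pow_two, ← map_mul]; exact map_dvd θ h1)
  have hrad : (Ideal.span {χ f}).IsRadical := (isRadical_iff_span_singleton.mp hsq.isRadical)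
  exact stalkIdeal_vanishingIdeal_closure_range_eq_span ι hd hF hZ i y₁ χ hχI hχsupp hrad

/-- **(B4γ) `ndInv_init` — `ND.NDInv` holds at the INITIAL STAGE `(ℙⁿ_k, 𝟙, range ι)`** with `m` the number of non-regular points, under the
hypotheses of the ND rung (SPEC `Cruxes/EquisingularLiftNatThree/NewtonNondegenerateRungK5.lean` §13.10 signature VERBATIM; `p`, `CharP`,
`hloc` are not used).  `ℙⁿ_k` is regular (tree `isRegular_projectiveSpace`); the `S`-block is (γ2) `exists_finset_nonregular_range`
(p642906); the frame at each `x ∈ S` is `exists_isNDFrameAt_of_isoHypNDWon`. [OURS · L1 W4.5b · DEAL «ND-K5» brick (B4γ), BY NAME] -/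
theorem ndInv_init (n : ℕ) (p : ℕ) (_hp : p.Prime) (k : Type) [Field k] [CharP k p] [IsAlgClosed k]
    (H : AlgebraicGeometry.Scheme.{0}) (ι : H ⟶ (Literature.AlgebraicGeometry.Motives.projectiveSpace n k).left)
    (hι : AlgebraicGeometry.IsClosedImmersion ι) (hH : AlgebraicGeometry.IsIntegral H)
    (_hloc : ∀ y : (Literature.AlgebraicGeometry.Motives.projectiveSpace n k).left,
      ∃ U : (Literature.AlgebraicGeometry.Motives.projectiveSpace n k).left.affineOpens,
        y ∈ (U : (Literature.AlgebraicGeometry.Motives.projectiveSpace n k).left.Opens) ∧ (ι.ker.ideal U).IsPrincipal)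
    (hfin : Set.Finite {x : H | ¬ IsRegularLocalRing (H.presheaf.stalk x)})
    (hND : IsoHypNDWon k n H ι) :
    ∃ m, NDInv n k m (Literature.AlgebraicGeometry.Motives.projectiveSpace n k).left (𝟙 (Literature.AlgebraicGeometry.Motives.projectiveSpace n k).left) (Set.range ι) := by
  classical
  haveI := hι
  haveI := hH
  obtain ⟨S, hS, hS'⟩ := exists_finset_nonregular_range ι hfin
  refine ⟨S.card, isRegular_projectiveSpace n k, S, rfl, hS, fun x hx => ?_⟩
  obtain ⟨hz, hxcl, x₀, hx₀, hnreg⟩ := hS' x hx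
  exact ⟨hz, hxcl, exists_isNDFrameAt_of_isoHypNDWon ι hND hnreg hx₀ hxcl⟩

end Summit.ResolutionOfSingularities.ResolutionOfSingularities.Cruxes.EquisingularLiftNat.Sections.ND

end
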